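import Literature.Algebra.Polynomial.ShefferEigenoperator
import Mathlib.Tactic
import HarnessLib

/-!
# The eigen-operator of a Sheffer set expanded in powers of another delta operator (Rota–Kahaner–Odlyzko §9, Corollaries 1–2)

G.-C. Rota, D. Kahaner, A. Odlyzko, *Finite operator calculus* (1973), §9, pp. 719–720, after
Theorem 9 (the operator `A = x Q (Q′)⁻¹ − (log S)′ Q (Q′)⁻¹` with `A s_n = n s_n` for the Sheffer set
of `Q`, `S`; tree: `shefferEigenOp φ σ` for `Q = D φ(D)`, `S = σ(D)`, `ShefferEigenoperator`):

> **Corollary 1.** Let `R` be a delta operator with basic polynomials `r_k (x)`. Then the operator `A`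
> defined previously can be expressed in the form `A = Σ_{k≥0} (a_k + x b_k)/k! · Rᵏ`, with
> `a_k = −[(log S)′ Q (Q′)⁻¹ r_k (x)]_{x=0}`, `b_k = [Q (Q′)⁻¹ r_k (x)]_{x=0}`.
> *Proof.* From the preceding proof we have `T = Σ_k (a_k + a b_k)/k! Rᵏ`, whence the conclusion upon
> interchanging the roles of the variables `x` and `a`, as in the proof of Theorem 8. The computation of
> the coefficients `a_k` and `b_k` is greatly simplified by use of the corollary to Theorem 4 and by
> various umbral devices. The generating functions associated with the `a_k` and `b_k` are now easily
> found; they are immediate consequences of the isomorphism theorem: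
> **Corollary 2.** Let `Q = φ̂ (R)` and `S = ψ̂ (R)`, where `φ̂` and `ψ̂` are formal power series. Then
> `Σ_k a_k tᵏ/k! = −ψ̂′(t) φ̂ (t)/(ψ̂ (t) φ̂′(t))` and `Σ_k b_k tᵏ/k! = φ̂ (t)/φ̂′(t)`.

Typed here (all proved): Corollary 1 for an arbitrary delta operator `R` with basic set `(r_k)`
(`shefferEigenOp_apply_eq_sum_pow` — the First Expansion Theorem, tree
`IsShiftInvariant.eq_sum_pow_apply`, applied to the two composition-operator parts `Q (Q′)⁻¹ = u(D)` and
`(log S)′ Q (Q′)⁻¹ = (σ′σ⁻¹ u)(D)` of `A`, `u = (tφ)/(tφ)′`), its specialisation `R = D`, `r_k = xᵏ`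
(`shefferEigenOp_apply_eq_sum_iterate_derivative`: `a_k/k! = −[tᵏ] σ′σ⁻¹u`, `b_k/k! = [tᵏ] u`), and
Corollary 2 in the case `R = D` (so `φ̂ = tφ`, `ψ̂ = σ`, and the prime is `d/dt`):
`Σ_k b_k tᵏ/k! = φ̂/φ̂′` (`egf_b_eq`) and `Σ_k a_k tᵏ/k! = −ψ̂′ φ̂/(ψ̂ φ̂′)` (`egf_a_eq`). The general-`R`
form of Corollary 2 is not typed here.

## References
* [RotaKahanerOdlyzko1973] G.-C. Rota, D. Kahaner, A. Odlyzko, *On the foundations of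
  combinatorial theory VIII. Finite operator calculus*, J. Math. Anal. Appl. 42 (1973) 684–760,
  §9 Corollaries 1–2 of Theorem 9, pp. 719–720.
-/

noncomputable section

open Polynomial Finset

namespace Literature.Algebra.Polynomial

variable {K : Type*} [Field K] [CharZero K]

/-- **Corollary 1**: for ANY delta operator `R` with basic set `(r_k)`, on every polynomial `f`
(`N > deg f`), `A f = Σ_{k<N} (a_k + x b_k)/k! · Rᵏ f` with `a_k = −[(log S)′ Q (Q′)⁻¹ r_k]_{x=0}` and
`b_k = [Q (Q′)⁻¹ r_k]_{x=0}` (here `Q (Q′)⁻¹ = u(D)`, `u = (tφ)·((tφ)′)⁻¹`, `(log S)′ = (σ′σ⁻¹)(D)`).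
[cite: RotaKahanerOdlyzko1973, §9 Theorem 9 Corollary 1, p. 719] -/
theorem shefferEigenOp_apply_eq_sum_pow (φ σ : PowerSeries K) {R : K[X] →ₗ[K] K[X]} {r : ℕ → K[X]}
    (hR : IsDeltaOperator R) (hr : IsBasicSequence R r) (f : K[X]) {N : ℕ} (hN : f.natDegree < N) :
    shefferEigenOp φ σ f = ∑ k ∈ range N,
      ((-(diffOp (PowerSeries.derivative K σ * σ⁻¹ *
            ((PowerSeries.derivative K (PowerSeries.X * φ))⁻¹ * (PowerSeries.X * φ))) (r k)).eval 0 /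
          (k.factorial : K)) • (R ^ k) f +
        ((diffOp ((PowerSeries.derivative K (PowerSeries.X * φ))⁻¹ * (PowerSeries.X * φ)) (r k)).eval 0 /
          (k.factorial : K)) • (X * (R ^ k) f)) := by
  rw [shefferEigenOp_apply, (isShiftInvariant_diffOp _).eq_sum_pow_apply hR hr f hN,
    (isShiftInvariant_diffOp (PowerSeries.derivative K σ * σ⁻¹ * _)).eq_sum_pow_apply hR hr f hN, mul_sum,
    ← sum_sub_distrib]
  refine sum_congr rfl fun k _ => ?_
  rw [mul_smul_comm, neg_div, neg_smul, sub_eq_add_neg, add_comm]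

/-- **Corollary 1 for `R = D`** (`r_k = xᵏ`): `A f = Σ_k (a_k + x b_k)/k! · Dᵏ f` with
`b_k/k! = [tᵏ] u` and `a_k/k! = −[tᵏ] (σ′σ⁻¹ u)`, `u = (tφ)/(tφ)′` (the coefficients "greatly simplified"
on the monomial basis). [cite: RotaKahanerOdlyzko1973, §9 Theorem 9 Corollary 1, p. 719] -/
theorem shefferEigenOp_apply_eq_sum_iterate_derivative (φ σ : PowerSeries K) (f : K[X]) {N : ℕ}
    (hN : f.natDegree < N) :
    shefferEigenOp φ σ f = ∑ k ∈ range N,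
      ((-PowerSeries.coeff k (PowerSeries.derivative K σ * σ⁻¹ *
            ((PowerSeries.derivative K (PowerSeries.X * φ))⁻¹ * (PowerSeries.X * φ)))) • derivative^[k] f +
        PowerSeries.coeff k ((PowerSeries.derivative K (PowerSeries.X * φ))⁻¹ * (PowerSeries.X * φ)) •
          (X * derivative^[k] f)) := by
  rw [shefferEigenOp_apply_eq_sum_pow φ σ isDeltaOperator_derivative isBasicSequence_derivative_X_pow f hN]
  refine sum_congr rfl fun k _ => ?_
  rw [neg_div, ← coeff_eq_eval_zero_diffOp, ← coeff_eq_eval_zero_diffOp, Module.End.pow_apply]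

/-- **Corollary 2, case `R = D`, the `b_k`**: `Σ_k b_k tᵏ/k! = φ̂ (t)/φ̂′(t)` for `Q = φ̂ (D)`,
`φ̂ = tφ` — the generating function of `b_k = [Q (Q′)⁻¹ xᵏ]_{x=0}` is the symbol `u = φ̂ (φ̂′)⁻¹` of
`Q (Q′)⁻¹` (the isomorphism theorem). [cite: RotaKahanerOdlyzko1973, §9 Theorem 9 Corollary 2, p. 720] -/
theorem egf_b_eq (φ : PowerSeries K) :
    (PowerSeries.mk fun k =>
        (diffOp ((PowerSeries.derivative K (PowerSeries.X * φ))⁻¹ * (PowerSeries.X * φ)) (X ^ k)).eval 0 /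
          (k.factorial : K)) =
      PowerSeries.X * φ * (PowerSeries.derivative K (PowerSeries.X * φ))⁻¹ := by
  rw [← indicator_derivative_eq, indicator_derivative_diffOp, mul_comm]

/-- **Corollary 2, case `R = D`, the `a_k`**: `Σ_k a_k tᵏ/k! = −ψ̂′(t) φ̂ (t)/(ψ̂ (t) φ̂′(t))` for
`Q = φ̂ (D)`, `S = ψ̂ (D)` (`φ̂ = tφ`, `ψ̂ = σ`): the generating function of
`a_k = −[(log S)′ Q (Q′)⁻¹ xᵏ]_{x=0}` is minus the symbol `σ′σ⁻¹ · φ̂ (φ̂′)⁻¹`.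
[cite: RotaKahanerOdlyzko1973, §9 Theorem 9 Corollary 2, p. 720] -/
theorem egf_a_eq (φ σ : PowerSeries K) :
    (PowerSeries.mk fun k =>
        -(diffOp (PowerSeries.derivative K σ * σ⁻¹ *
            ((PowerSeries.derivative K (PowerSeries.X * φ))⁻¹ * (PowerSeries.X * φ))) (X ^ k)).eval 0 /
          (k.factorial : K)) =
      -(PowerSeries.derivative K σ * (PowerSeries.X * φ) *
        (σ * PowerSeries.derivative K (PowerSeries.X * φ))⁻¹) := by
  have h : (PowerSeries.mk fun k =>
      -(diffOp (PowerSeries.derivative K σ * σ⁻¹ *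
          ((PowerSeries.derivative K (PowerSeries.X * φ))⁻¹ * (PowerSeries.X * φ))) (X ^ k)).eval 0 /
        (k.factorial : K)) =
      -(PowerSeries.mk fun k =>
        (diffOp (PowerSeries.derivative K σ * σ⁻¹ *
          ((PowerSeries.derivative K (PowerSeries.X * φ))⁻¹ * (PowerSeries.X * φ))) (X ^ k)).eval 0 /
        (k.factorial : K)) := by
    ext k
    rw [map_neg, PowerSeries.coeff_mk, PowerSeries.coeff_mk, neg_div]
  rw [h, ← indicator_derivative_eq, indicator_derivative_diffOp, PowerSeries.mul_inv_rev]
  ring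

end Literature.Algebra.Polynomial
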